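import Mathlib
import Summits.ValiantsHypothesis.ValiantsHypothesis.Theorems.BorderApolarityToricFixedPointsToricLimitIsInitial
import Summits.ValiantsHypothesis.ValiantsHypothesis.Theorems.BorderApolarityFixedWitnessObstructionQPAnnSubmodule
import Literature.Computability.AlgebraicComplexity.ApolarityAction

/-!
# Border apolarity, crux `ToricWitnessObstructionQP` (stmt-ValiantsHypothesis-14753) — line `Sketch`,
# reshape 4, stub `snf_finrank_initialSpan` (dimension of the lowest-weight initial span)

Route `ValiantsHypothesis/BorderApolarity`, crux item `stmt-ValiantsHypothesis-14753`, line `Sketch`,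
reshape 4 (structure of stable normal forms), helper stub `snf_finrank_initialSpan` (wave 3).

Claim.  For `g ∈ GL_{m²}`, an integer weight `w` and every degree `k`, the span
`in_w(Ann_k(g · det_m))` of the lowest-`w`-weight initial forms of the elements of the degree-`k`
annihilator of `g · det_m` has dimension `C(m² + k - 1, k) - C(m, k)²` (`= dim Ann_k(det_m)`).

Proof (flatness of the toric degeneration).  `A = Ann_k(g · det_m)` is a subspace of the
degree-`k` forms of dimension `d = C(m² + k - 1, k) - C(m, k)²` (`stub_annSubmodule`: the Hilbert
function of the apolar ideal is constant on the orbit `GL_{m²} · det_m`).  Along the torus curve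
`t ↦ diag((t+2)^w)` the pulled-back planes `B_t = diag((t+2)^w)⁻¹ A` are `d`-planes of degree-`k`
forms whose Kuratowski limit in the coefficient topology is `in_w(A)` — clause (Li) is
`tli_exists_approx`, clause (Ls) is `tli_limitMem` (crux `ToricFixedPoints`, the latter containing the
flatness inequality `dim in_w(A) ≥ dim A`).  A Kuratowski limit of `d`-planes of degree-`k` forms is a
`d`-plane (`stub_kuratowskiSubmodule`, closedness of the Grassmannian), whence `dim in_w(A) = d`.
-/

open MvPolynomial Filter
open scoped BigOperators Matrix
open Literature.Computability.AlgebraicComplexity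
open Summit.ValiantsHypothesis.ValiantsHypothesis.Theorems.BorderApolarityToricFixedPoints
  (tli_exists_approx tli_limitMem tli_finrank_comap_linSubst tli_isUnit_det_diagonal_zpow
    tli_natCast_add_two_ne_zero tli_linSubst_torus_neg_linSubst_torus)
open Summit.ValiantsHypothesis.ValiantsHypothesis.Theorems.BorderApolarityFixedWitnessObstructionQP
  (stub_kuratowskiSubmodule stub_annSubmodule)

-- the mandated summit-side namespace repeats a component by design (single-problem summit)
set_option linter.dupNamespace false

namespace Summit.ValiantsHypothesis.ValiantsHypothesis.Theorems.BorderApolarityToricWitnessObstructionQP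

/-- **Flatness of the initial degeneration, with equality.**  For a subspace `A` of degree-`k` forms
and an integer weight `w`, the span `in_w(A)` of the lowest-`w`-weight initial forms of the elements of
`A` has dimension exactly `dim A`: the pulled-back planes `B_t = diag((t+2)^w)⁻¹ A` are planes of
degree-`k` forms of dimension `dim A` whose Kuratowski limit (coefficient topology) is `in_w(A)`
((Li) `tli_exists_approx`, (Ls) `tli_limitMem`), and a Kuratowski limit of `d`-planes of degree-`k`
forms is a `d`-plane (`stub_kuratowskiSubmodule`). [folklore] -/
theorem snfdim_finrank_initialSpan_eq {σ : Type} [Fintype σ] [DecidableEq σ] (w : σ → ℤ) (k : ℕ)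
    (A : Submodule ℂ (MvPolynomial σ ℂ)) (hA : A ≤ homogeneousSubmodule σ ℂ k) :
    Module.finrank ℂ ↥(Submodule.span ℂ {D : MvPolynomial σ ℂ | ∃ E ∈ A, ∃ ν : ℤ,
      D = weightedHomogeneousComponent w ν E ∧
        ∀ ν' : ℤ, ν' < ν → weightedHomogeneousComponent w ν' E = 0}) = Module.finrank ℂ A := by
  have hc0 : ∀ s : ℕ, ((s : ℂ) + 2) ≠ 0 := tli_natCast_add_two_ne_zero
  -- the moving planes `B s = diag((s+2)^w)⁻¹ A`
  set B : ℕ → Submodule ℂ (MvPolynomial σ ℂ) := fun s =>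
    A.comap (linSubst σ ℂ (Matrix.diagonal fun i => ((s : ℂ) + 2) ^ w i)).toLinearMap
  have hBmem : ∀ (s : ℕ) (H : MvPolynomial σ ℂ),
      H ∈ B s ↔ linSubst σ ℂ (Matrix.diagonal fun i => ((s : ℂ) + 2) ^ w i) H ∈ A :=
    fun s H => Iff.rfl
  have hBle : ∀ s, B s ≤ homogeneousSubmodule σ ℂ k := by
    intro s H hH
    rw [← tli_linSubst_torus_neg_linSubst_torus _ (hc0 s) w H]
    exact linSubst_mem_homogeneousSubmodule _ (hA ((hBmem s H).1 hH))
  have hBfin : ∀ s, Module.finrank ℂ (B s) = Module.finrank ℂ A := fun s =>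
    tli_finrank_comap_linSubst _ (tli_isUnit_det_diagonal_zpow _ (hc0 s) w) A
  -- the initial span is the Kuratowski limit of the `B s`
  set In := Submodule.span ℂ {D : MvPolynomial σ ℂ | ∃ E ∈ A, ∃ ν : ℤ,
    D = weightedHomogeneousComponent w ν E ∧
      ∀ ν' : ℤ, ν' < ν → weightedHomogeneousComponent w ν' E = 0}
  -- (Li): explicit approximants of the lowest forms
  have hLi : ∀ D ∈ (In : Set (MvPolynomial σ ℂ)), ∃ Ds : ℕ → MvPolynomial σ ℂ,
      (∀ t, Ds t ∈ B t) ∧ Tendsto (fun t => coeffVec (Ds t)) atTop (nhds (coeffVec D)) := by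
    intro D hD
    have hD' : D ∈ In := hD
    obtain ⟨H, hH, hl⟩ := tli_exists_approx w k A hA (ψ := fun t => t) tendsto_id hD'
    exact ⟨H, fun t => (hBmem t (H t)).2 (hH t).2, hl⟩
  -- (Ls): every subsequential limit from the planes `B (φ t)` lies in the initial span
  have hLs : ∀ (D : MvPolynomial σ ℂ) (φ : ℕ → ℕ) (Ds : ℕ → MvPolynomial σ ℂ), StrictMono φ →
      (∀ t, Ds t ∈ B (φ t)) → Tendsto (fun t => coeffVec (Ds t)) atTop (nhds (coeffVec D)) →
        D ∈ (In : Set (MvPolynomial σ ℂ)) := by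
    intro D φ Ds hφ hDs hlim
    exact tli_limitMem w k A hA hφ (fun t => (hBmem (φ t) (Ds t)).1 (hDs t)) hlim
  obtain ⟨Lk, hLk, -, hfin⟩ := stub_kuratowskiSubmodule k (Module.finrank ℂ A) B
    (In : Set (MvPolynomial σ ℂ)) hBle hBfin hLi hLs
  have hLkIn : Lk = In := SetLike.coe_injective hLk
  rw [← hLkIn]
  exact hfin

/-- W3f: the dimension of the lowest-weight initial span of `Ann_k(g · det_m)`: for `g ∈ GL_{m²}`, an
integer weight `w` and every `k`, `dim in_w(Ann_k(g · det_m)) = C(m² + k - 1, k) - C(m, k)²`, the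
value of the Hilbert function of `det_m^⊥` (`stub_annSubmodule`) — the toric degeneration
`A ↦ in_w(A)` is flat (`snfdim_finrank_initialSpan_eq`). [folklore] -/
theorem snf_finrank_initialSpan : ∀ (m k : ℕ) (g : GL (Fin m × Fin m) ℂ) (w : Fin m × Fin m → ℤ),
    Module.finrank ℂ ↥(Submodule.span ℂ {D' : MvPolynomial (Fin m × Fin m) ℂ |
      ∃ E ∈ annihilatorOfDegree
        (linSubst (Fin m × Fin m) ℂ (g : Matrix (Fin m × Fin m) (Fin m × Fin m) ℂ) (detPoly (Fin m) ℂ)) k,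
      ∃ ν : ℤ, D' = weightedHomogeneousComponent w ν E ∧
        ∀ ν' : ℤ, ν' < ν → weightedHomogeneousComponent w ν' E = 0}) =
    Nat.choose (m * m + k - 1) k - (Nat.choose m k) ^ 2 := by
  intro m k g w
  have hF : linSubst (Fin m × Fin m) ℂ (g : Matrix (Fin m × Fin m) (Fin m × Fin m) ℂ)
      (detPoly (Fin m) ℂ) ∈ glOrbit (Fin m × Fin m) ℂ (detPoly (Fin m) ℂ) := ⟨g, rfl⟩
  obtain ⟨A, hAcoe, hAle, hdim⟩ := stub_annSubmodule m k _ hF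
  have hmemA : ∀ E, E ∈ A ↔ E ∈ annihilatorOfDegree
      (linSubst (Fin m × Fin m) ℂ (g : Matrix (Fin m × Fin m) (Fin m × Fin m) ℂ)
        (detPoly (Fin m) ℂ)) k :=
    fun E => by rw [← SetLike.mem_coe, hAcoe]
  have hset : {D' : MvPolynomial (Fin m × Fin m) ℂ | ∃ E ∈ annihilatorOfDegree
        (linSubst (Fin m × Fin m) ℂ (g : Matrix (Fin m × Fin m) (Fin m × Fin m) ℂ)
          (detPoly (Fin m) ℂ)) k,
      ∃ ν : ℤ, D' = weightedHomogeneousComponent w ν E ∧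
        ∀ ν' : ℤ, ν' < ν → weightedHomogeneousComponent w ν' E = 0} =
      {D' : MvPolynomial (Fin m × Fin m) ℂ | ∃ E ∈ A, ∃ ν : ℤ,
        D' = weightedHomogeneousComponent w ν E ∧
          ∀ ν' : ℤ, ν' < ν → weightedHomogeneousComponent w ν' E = 0} := by
    ext D'
    simp only [Set.mem_setOf_eq, hmemA]
  rw [hset, snfdim_finrank_initialSpan_eq w k A hAle, hdim]

end Summit.ValiantsHypothesis.ValiantsHypothesis.Theorems.BorderApolarityToricWitnessObstructionQP
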